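import Literature.AlgebraicGeometry.AbelianSchemes.TorsionSectionPairingBaseChange
import Literature.AlgebraicGeometry.AbelianSchemes.AbelianSchemeDualIsogeny
import HarnessLib

/-!
# The pairing units are NATURAL in the homomorphism: `e_n^A(g, ψ^∨ c) = e_n^B(g, c)` («`e_n(x, ψ^∨ ŷ) = e_n(ψ x, ŷ)`»)

Layer `Literature/AlgebraicGeometry/AbelianSchemes`; namespaces `Literature.AlgebraicGeometry.AbelianSchemes.AbelianSchemeOver.DualPair` (§1–§2) and
`…AbelianSchemeOver.TorsionPairing` (§3).  THEOREMS ONLY (no definition, no instance, no notation, no named fact, no `sorry`).  Cell `hodgecm-mathlib`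
(D-0151), P6 «MOD programme» (crux hLiu418, `--supports`), P6b line `Cruxes/HLiu418/Lines/F0_P6b_WeilCartierDuality.lean` (`stub_W1` «WeilPairingNatural»,
σ1 plan of record B-p08 (g32) `ROAD-sigma1-WeilPairingNatural.v1`, LEAD F0P6-plan (g2) M-17v (3)): organ **(σ1-e) NATURALITY** (A-p03 (g29)), the unit-level
adjunction of `ψ` and its dual `ψ^∨` under the character pairing — the content of `IsNatural`.2 before the morphism `w₀ : Ĝ → G^D` of (σ1-a) is formed.
HC_CM is proved only modulo the printed citations until rung 0 closes; nothing here is about HC.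

THE MATHEMATICS ([MumfordAV1970] §20 pp. 184–186, property (I) «`e_n(f(x), y) = e_n(x, f̂(y))`»; [MilneAV2008] I §13 Prop. 13.2 (b); [MumfordAV1970] §15 Thm. 1
for `f̂`).  Let `ψ : A → B` be a homomorphism of abelian schemes over `S`, `ψ^∨ : B̂ → Â` its dual (★ `DualPair.dualIsogeny`, the morphism classifying
`(ψ × 1)^*𝒫_B`, with ★ (e1) `(1 × ψ^∨)^*𝒫_A ≅ (ψ × 1)^*𝒫_B` over `B̂`), `f : T → S` and `c : T → B̂` an `S`-morphism (a `T`-point of `B̂`).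
§1 The cube: `(1_A × c) ≫ (ψ × 1_{B̂}) = ψ_T ≫ (1_B × c)` as maps `A_T → B ×_S B̂`.  §2 Hence **`L_{ψ^∨ c} ≅ ψ_T^* L_c` on `A_T`**: pull (e1) back along
`1_A × c` and recompose the pull-backs (Mathlib `Scheme.Modules.pullbackComp ∕ pullbackCongr`, ★ `baseChangeToProd_comp`) — the «`L′ ≅ ι^*L`» input of ★
`TorsionSectionPairingBaseChange` for the square `ι := ψ_T : A_T → B_T` over `t := 𝟙 T`.  §3 **THE HEAD**: `ψ_T` commutes with `[n]` (homomorphism) and,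
for actions `ρ_A` on `A_T` over `[n]_{A_T}` and `ρ_B` on `B_T` over `[n]_{B_T}` of one group `K` INTERTWINED by `ψ_T` (e.g. translations by `n`-torsion
sections `x` of `A_T` and by `ψ x` — ★ translation naturality), ★ `pairingUnit_baseChange` gives, for ANY trivialisations `e_A` of `[n]^* L_{ψ^∨ c}` and
`e_B` of `[n]^* L_c` with pairing units `u_A`, `u_B`: **`u_A g = u_B g`** — Mumford՚s (I) read at the universal point, the identity that (σ1-f) combines with
(σ1-a)՚s points formula to the square `βd ≫ w_A = w_B ≫ β^D`.

MAIN STATEMENTS.  §1 `DualPair.baseChangeToProd_comp_baseChangeHom_left`; §2 **`DualPair.nonempty_pullbackP_comp_dualIsogenyOver_iso`**; §3 `baseChangeHom_left_comp_mulN_left`,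
`nonempty_pullback_baseChangeHom_unit_iso_unit`, **`TorsionPairing.pairingUnit_eq_of_dualIsogeny`**.

## References
* [MumfordAV1970] D. Mumford, *Abelian Varieties* (1970), §15 Thm. 1 (p. 143); §20 (pp. 184–186), property (I).
* [MilneAV2008] J. S. Milne, *Abelian Varieties* (2008), I §8 pp. 36–37; I §13 Prop. 13.2.
-/

set_option autoImplicit false

noncomputable section

-- `TopCat.Presheaf`/`Scheme.Modules` are not reducible (as in Mathlib's `AlgebraicGeometry/Modules` and ★ `TorsionSectionPairingBaseChange`).
set_option backward.isDefEq.respectTransparency false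

universe u

open CategoryTheory CategoryTheory.Limits AlgebraicGeometry MonoidalCategory CartesianMonoidalCategory TopologicalSpace Opposite
open scoped MonObj

namespace Literature.AlgebraicGeometry.AbelianSchemes.AbelianSchemeOver

open Literature.AlgebraicGeometry.RelativeSpec Literature.AlgebraicGeometry.Modules Literature.AlgebraicGeometry.Motives
  Literature.AlgebraicGeometry.HodgeTheory Literature.AlgebraicGeometry.Morphisms
  Literature.AlgebraicGeometry.RelativeSpec.ActionOver

variable {S : Scheme.{u}} {A B : AbelianSchemeOver S} (ψ : A.X ⟶ B.X) [IsMonHom ψ] (DA : A.DualPair) (DB : B.DualPair)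
  {T : Scheme.{u}} (f : T ⟶ S)

namespace DualPair

/-! ### §1 The cube `(1_A × c) ≫ (ψ × 1_{B̂}) = ψ_T ≫ (1_B × c)` -/

omit [IsMonHom ψ] in
/-- `(1_A × c) ≫ (ψ × 1_{B̂}) = ψ_T ≫ (1_B × c) : A_T → B ×_S B̂` (both are `(pr_A ≫ ψ, pr_T ≫ c)`). [cite: MilneAV2008, I §8 pp. 36–37] -/
theorem baseChangeToProd_comp_baseChangeHom_left (c : T ⟶ DB.hat.X.left) (hc : c ≫ DB.hat.X.hom = f) :
    A.baseChangeToProd DB.hat f c hc ≫ (baseChangeHom ψ DB.hat.X.hom).left =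
      (baseChangeHom ψ f).left ≫ B.baseChangeToProd DB.hat f c hc := by
  have hsndB : (baseChangeHom ψ DB.hat.X.hom).left ≫ pullback.snd B.X.hom DB.hat.X.hom = pullback.snd A.X.hom DB.hat.X.hom :=
    Over.w (baseChangeHom ψ DB.hat.X.hom)
  have hsndT : (baseChangeHom ψ f).left ≫ pullback.snd B.X.hom f = pullback.snd A.X.hom f := Over.w (baseChangeHom ψ f)
  apply pullback.hom_ext
  · rw [Category.assoc, baseChangeHom_left_comp_fst, ← Category.assoc, baseChangeToProd_fst, Category.assoc, baseChangeToProd_fst,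
      baseChangeHom_left_comp_fst]
  · rw [Category.assoc, hsndB, baseChangeToProd_snd, Category.assoc, baseChangeToProd_snd, reassoc_of% hsndT]

/-! ### §2 `L_{ψ^∨ c} ≅ ψ_T^* L_c` on `A_T` -/

/-- **`L_{ψ^∨ c} ≅ ψ_T^* L_c`**: for a `T`-point `c` of `B̂` over `f`, the slice `(1_A × (c ≫ ψ^∨))^*𝒫_A` of the Poincaré sheaf of `A` at the point `c ≫ ψ^∨` of
`Â` is the pull-back along `ψ_T : A_T → B_T` of the slice `(1_B × c)^*𝒫_B` — ★ (e1) `nonempty_pullbackP_dualIsogeny_iso` pulled back along `1_A × c`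
and recomposed through the cube of §1.  This is the «`L′ ≅ ι^*L`» input of ★ `TorsionSectionPairingBaseChange.pairingUnit_baseChange` for `ι := ψ_T`,
`t := 𝟙 T`. [cite: MumfordAV1970, §15 Thm. 1 (p. 143)] [cite: MilneAV2008, I §8 pp. 36–37] -/
theorem nonempty_pullbackP_comp_dualIsogenyOver_iso (c : Over.mk f ⟶ DB.hat.X) :
    Nonempty (DA.pullbackP f (c ≫ dualIsogenyOver ψ DA DB).left (Over.w (c ≫ dualIsogenyOver ψ DA DB)) ≅
      (Scheme.Modules.pullback (baseChangeHom ψ f).left).obj (DB.pullbackP f c.left (Over.w c))) := by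
  obtain ⟨e1⟩ := nonempty_pullbackP_dualIsogeny_iso ψ DA DB
  -- `1_A × (c ≫ ψ^∨) = (1_A × c) ≫ (1_A × ψ^∨)`
  have hcomp : A.baseChangeToProd DA.hat f (c ≫ dualIsogenyOver ψ DA DB).left (Over.w (c ≫ dualIsogenyOver ψ DA DB)) =
      A.baseChangeToProd DB.hat f c.left (Over.w c) ≫
        A.baseChangeToProd DA.hat DB.hat.X.hom (dualIsogeny ψ DA DB) (dualIsogeny_comp_hom ψ DA DB) :=
    baseChangeToProd_comp (A := A) f c.left (dualIsogeny ψ DA DB) (Over.w c) (dualIsogeny_comp_hom ψ DA DB)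
  -- the cube
  have hsq := baseChangeToProd_comp_baseChangeHom_left ψ DB f c.left (Over.w c)
  exact ⟨(Scheme.Modules.pullbackCongr hcomp).app DA.P ≪≫
    ((Scheme.Modules.pullbackComp (A.baseChangeToProd DB.hat f c.left (Over.w c))
        (A.baseChangeToProd DA.hat DB.hat.X.hom (dualIsogeny ψ DA DB) (dualIsogeny_comp_hom ψ DA DB))).app DA.P).symm ≪≫
    (Scheme.Modules.pullback (A.baseChangeToProd DB.hat f c.left (Over.w c))).mapIso e1 ≪≫
    (Scheme.Modules.pullbackComp (A.baseChangeToProd DB.hat f c.left (Over.w c)) (baseChangeHom ψ DB.hat.X.hom).left).app DB.P ≪≫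
    (Scheme.Modules.pullbackCongr hsq).app DB.P ≪≫
    ((Scheme.Modules.pullbackComp (baseChangeHom ψ f).left (B.baseChangeToProd DB.hat f c.left (Over.w c))).app DB.P).symm⟩

end DualPair

/-! ### §3 THE HEAD: the pairing units of `(A, ψ^∨ c)` and `(B, c)` coincide for intertwined actions -/

namespace TorsionPairing

/-- **`ψ_T` commutes with `[n]`** (on underlying schemes): `ψ_T ≫ [n]_{B_T} = [n]_{A_T} ≫ ψ_T` — `ψ_T` is a homomorphism (★ `isMonHom_baseChangeHom`) and
`[n] = 𝟙ⁿ`. [cite: MumfordFogartyKirwan1994, Ch. 6 §1 Cor. 6.4 (p. 117)] -/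
theorem baseChangeHom_left_comp_mulN_left (n : ℕ) :
    (baseChangeHom ψ f).left ≫ ((B.baseChange f).mulN n).left = ((A.baseChange f).mulN n).left ≫ (baseChangeHom ψ f).left := by
  haveI := isMonHom_baseChangeHom ψ f
  rw [← Over.comp_left, ← Over.comp_left]
  congr 1
  rw [mulN_def, mulN_def, MonObj.comp_pow, MonObj.pow_comp, Category.comp_id, Category.id_comp]

omit [IsMonHom ψ] in
/-- `ψ_T^* 𝒪_{B_T} ≅ 𝒪_{A_T}` (the unit of pull-back; the functor on opens is final). [cite: Hartshorne1977, II §5 p. 110 (f^*𝒪_Y = 𝒪_X)] -/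
theorem nonempty_pullback_baseChangeHom_unit_iso_unit :
    Nonempty ((Scheme.Modules.pullback (baseChangeHom ψ f).left).obj (SheafOfModules.unit (B.baseChange f).X.left.ringCatSheaf) ≅
      SheafOfModules.unit (A.baseChange f).X.left.ringCatSheaf) := by
  have hI : IsIso (SheafOfModules.pullbackObjUnitToUnit (baseChangeHom ψ f).left.toRingCatSheafHom) := by
    haveI := Literature.AlgebraicGeometry.KTheory.final_opensMap (baseChangeHom ψ f).left
    exact SheafOfModules.instIsIsoPullbackObjUnitToUnitOfFinal _
  exact ⟨@asIso _ _ _ _ (SheafOfModules.pullbackObjUnitToUnit (baseChangeHom ψ f).left.toRingCatSheafHom) hI⟩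

/-- **NATURALITY OF THE PAIRING UNITS** ([MumfordAV1970] §20 (I) «`e_n(f(x), y) = e_n(x, f̂(y))`», read at a universal point): let `ρ_A`, `ρ_B` be actions of one
group `K` on `A_T` over `[n]_{A_T}` and on `B_T` over `[n]_{B_T}`, INTERTWINED by `ψ_T` (`hι`; e.g. translations by `n`-torsion sections `x` of `A_T` and by
`ψ x`), `c` a `T`-point of `B̂`, `e_B` ANY trivialisation of `[n]^* L_c` with pairing units `u_B` (★ `exists_poincarePairingUnit_fun`), and `e_A` ANY
trivialisation of `[n]^* L_{c ≫ ψ^∨}` with pairing units `u_A`.  Then `u_A g = u_B g` for every `g ∈ K` (★ `pairingUnit_baseChange` along `ι := ψ_T` over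
`t := 𝟙 T`, with `L′ ≅ ι^*L` from §2). [cite: MumfordAV1970, §20 (pp. 184–186)] [cite: MilneAV2008, I §13 Prop. 13.2] -/
theorem pairingUnit_eq_of_dualIsogeny [IsLocallyNoetherian T] {K : Type u} [Group K] {n : ℕ} (c : Over.mk f ⟶ DB.hat.X)
    (ρA : ActionOver ((A.baseChange f).mulN n).left K) (ρB : ActionOver ((B.baseChange f).mulN n).left K)
    (hι : ∀ g : K, ρA.autHom g ≫ (baseChangeHom ψ f).left = (baseChangeHom ψ f).left ≫ ρB.autHom g)
    (eB : (Scheme.Modules.pullback ((B.baseChange f).mulN n).left).obj (DB.pullbackP f c.left (Over.w c)) ≅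
      (Scheme.Modules.pullback ((B.baseChange f).mulN n).left).obj (SheafOfModules.unit (B.baseChange f).X.left.ringCatSheaf))
    (uB : K → Γ(T, ⊤))
    (huB : ∀ g : K, (Scheme.Modules.pullback (ρB.autHom g)).map eB.hom ≫
        ((EquivariantStructure.ofPullback ρB (SheafOfModules.unit (B.baseChange f).X.left.ringCatSheaf)).iso g).hom =
      ((EquivariantStructure.ofPullback ρB (DB.pullbackP f c.left (Over.w c))).iso g).hom ≫ eB.hom ≫
        globalScalar _ (((B.baseChange f).mulN n).left.appTop ((B.baseChange f).X.hom.appTop (uB g))))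
    (eA : (Scheme.Modules.pullback ((A.baseChange f).mulN n).left).obj
        (DA.pullbackP f (c ≫ DualPair.dualIsogenyOver ψ DA DB).left (Over.w (c ≫ DualPair.dualIsogenyOver ψ DA DB))) ≅
      (Scheme.Modules.pullback ((A.baseChange f).mulN n).left).obj (SheafOfModules.unit (A.baseChange f).X.left.ringCatSheaf))
    (uA : K → Γ(T, ⊤))
    (huA : ∀ g : K, (Scheme.Modules.pullback (ρA.autHom g)).map eA.hom ≫
        ((EquivariantStructure.ofPullback ρA (SheafOfModules.unit (A.baseChange f).X.left.ringCatSheaf)).iso g).hom =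
      ((EquivariantStructure.ofPullback ρA
          (DA.pullbackP f (c ≫ DualPair.dualIsogenyOver ψ DA DB).left (Over.w (c ≫ DualPair.dualIsogenyOver ψ DA DB)))).iso g).hom ≫
        eA.hom ≫ globalScalar _ (((A.baseChange f).mulN n).left.appTop ((A.baseChange f).X.hom.appTop (uA g))))
    (g : K) : uA g = uB g := by
  obtain ⟨j₁⟩ := DualPair.nonempty_pullbackP_comp_dualIsogenyOver_iso ψ DA DB f c
  obtain ⟨j₀⟩ := nonempty_pullback_baseChangeHom_unit_iso_unit ψ f (A := A) (B := B)
  have ht : (baseChangeHom ψ f).left ≫ (B.baseChange f).X.hom = (A.baseChange f).X.hom ≫ 𝟙 T := by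
    rw [Category.comp_id]; exact Over.w (baseChangeHom ψ f)
  have h := pairingUnit_baseChange (𝟙 T) (baseChangeHom ψ f).left ht (baseChangeHom_left_comp_mulN_left ψ f n) ρB ρA hι
    (DB.pullbackP f c.left (Over.w c)) (hasRank_pullbackP DB f c) eB _ j₁ j₀ uB huB eA g (uA g) (huA g)
  rw [h, Scheme.Hom.id_appTop]
  rfl

end TorsionPairing

end Literature.AlgebraicGeometry.AbelianSchemes.AbelianSchemeOver

end
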